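import Literature.Computability.AlgebraicComplexity.UniversalCircuitInt
import Literature.Computability.AlgebraicComplexity.ConstantFreeCircuits
import HarnessLib

/-!
# The integer universal circuit is CONSTANT-FREE (Raz 2010; Forbes–Shpilka–Volk 2018, Thm. 12;
# Chatterjee–Tengse 2023, proof of Lemma 4.7)

Topic `Literature/Computability/AlgebraicComplexity`; continues `UniversalCircuit.lean` /
`UniversalCircuitInt.lean`. Those files bound the ORDINARY fan-in-two complexity
`complexity U ≤ 21877 (n+d+s+2)²⁶` of the integer universal polynomial `U ∈ ℤ[x, y]`
(`RazUniversal.exists_universalCircuit_int`), a measure that lets a circuit use arbitrary ring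
constants. Chatterjee–Tengse's Lemma 4.7 (arXiv:2309.07612v2; v1 Lemma 50, held text
`paper:arxiv-2309.07612` p0017.txt:L58–L70: "consider the universal circuit 𝒰(x, y) … which is
constant-free") needs the CONSTANT-FREE size: a fan-in-two circuit over `ℤ` all of whose constants
and sum coefficients lie in `{0, 1, −1}` (the tree's `constantFreeComplexity`, Bürgisser's `τ`).
This file records that the same construction is constant-free with the same size bound: Raz's
flattened universal circuit-graph `jointOut ℤ σ r N` is assembled from label VARIABLES in place of
weights (sums of products of two symbols, substituted level by level), so no constant other than
`0, 1` ever enters (`RazUniversal.constantFreeComplexity_jointOut_le`, the `τ`-twin of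
`RazUniversal.complexity_jointOut_le`, proved along the same substitution schedule with the tree's
`τ`-calculus `constantFreeComplexity_aeval_le` / `_add_le` / `_mul_le` / `_finset_sum_le`), and hence
**`RazUniversal.exists_universalCircuit_int_constantFree`**: ONE integer polynomial
`U ∈ ℤ[x₁,…,x_n, y₁,…,y_p]`, `p ≤ 9376 (n+d+s+2)²⁶`, of CONSTANT-FREE complexity
`≤ 21877 (n+d+s+2)²⁶`, `x`-degree `≤ d` per monomial, total degree `≤ 3d + 1`, universal for all
`f` of degree `≤ d` and complexity `≤ s` over every commutative ring (same universality proof as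
`exists_universalCircuit_int`, whose Lean text is adapted here; only the size measure changes).
Also `constantFreeComplexity_C_natCast_le` (`τ(m) ≤ m`, for specialising inputs to small natural
constants, as Lemma 4.7's evaluation points need).

Brick E-g0 of the X-CT23 engine (cell val-lit, t18 g8): consumed by the Lemma 4.7 layer
(`CT23_lemma_4_7`). Theorems only; no definitions, no named facts. Honest framing: routine
bookkeeping on a construction already in the tree; `VP ≠ VNP` is NOT proved and nothing here bears
on it.

## References

* [Raz2010] R. Raz, *Elusive functions and lower bounds for arithmetic circuits*, Theory Comput. 6
  (2010) 135–177, Prop. 2.8 (pp. 154–155), §3.2 (p. 157: the labels are the only constants of the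
  universal circuit), Prop. 3.3 (p. 158).
* [ForbesShpilkaVolk2018] M. A. Forbes, A. Shpilka, B. L. Volk, *Succinct hitting sets and barriers
  to proving lower bounds for algebraic circuits*, Theory Comput. 14 (2018), Thm. 12 (seq.) = ToC
  Thm. 3.1.
* [ChatterjeeTengse2023] P. Chatterjee, A. Tengse, *Lower Bounds from Succinct Hitting Sets*,
  arXiv:2309.07612v2, proof of Lemma 4.7 (v1: Lemma 50; p0017.txt:L58–L70).
* [Burgisser2000] P. Bürgisser, *Completeness and Reduction in Algebraic Complexity Theory* (2000),
  §1.4 (constant-free model), Rem. 2.7 (substitution).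
-/

noncomputable section

namespace Literature.Computability.AlgebraicComplexity

open MvPolynomial

namespace RazUniversal

universe u v

/-! ### §1. The flattened universal circuit-graph is constant-free: `τ(OUT) ≤ 2B + r (rN)(4B+1)` -/

section Joint

variable {σ : Type v} [Fintype σ] {r N : ℕ}

omit [Fintype σ] in
/-- Its variables are among the symbols used (twin of the private lemma of
`RazUniversalJoint.lean`, over `ℤ`). [folklore] -/
private theorem vars_varWeightedSum_subset_int {Z : Type*} [DecidableEq Z] {ι : Type*} [Fintype ι]
    (l z : ι → Z) :
    (∑ i, (X (l i) : MvPolynomial Z ℤ) * X (z i)).vars ⊆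
      Finset.univ.image l ∪ Finset.univ.image z := by
  intro v hv
  have h := vars_sum_subset (t := Finset.univ)
    (φ := fun i => (X (l i) : MvPolynomial Z ℤ) * X (z i)) hv
  simp only [Finset.mem_biUnion, Finset.mem_univ, true_and] at h
  obtain ⟨i, hi⟩ := h
  have h2 := vars_mul _ _ hi
  rw [vars_X, vars_X] at h2
  rcases Finset.mem_union.mp h2 with h3 | h3
  · have := Finset.mem_singleton.mp h3; subst this
    exact Finset.mem_union_left _ (Finset.mem_image.mpr ⟨i, Finset.mem_univ _, rfl⟩)
  · have := Finset.mem_singleton.mp h3; subst this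
    exact Finset.mem_union_right _ (Finset.mem_image.mpr ⟨i, Finset.mem_univ _, rfl⟩)

omit [Fintype σ] in
/-- Evaluating a sum of products of symbols (twin of the private lemma of `RazUniversalJoint.lean`).
[folklore] -/
private theorem aeval_varWeightedSum_int {Z : Type*} {ι : Type*} [Fintype ι] {A : Type*}
    [CommSemiring A] [Algebra ℤ A] (V : Z → A) (l z : ι → Z) :
    aeval V (∑ i, (X (l i) : MvPolynomial Z ℤ) * X (z i)) = ∑ i, V (l i) * V (z i) := by
  simp [map_sum]

omit [Fintype σ] in
/-- A sum of `#ι` products of two symbols costs `≤ 2 #ι` CONSTANT-FREE gates (`τ`-twin of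
`complexity_varWeightedSum_le`). [cite: Burgisser2000, §1.4, §2.1] -/
theorem constantFreeComplexity_varWeightedSum_le {Z : Type*} {ι : Type*} [Fintype ι] (l z : ι → Z) :
    constantFreeComplexity (∑ i, (X (l i) : MvPolynomial Z ℤ) * X (z i)) ≤ 2 * Fintype.card ι := by
  refine (constantFreeComplexity_finset_sum_le _ _).trans ?_
  have h1 : ∀ i, constantFreeComplexity ((X (l i) : MvPolynomial Z ℤ) * X (z i)) ≤ 1 := fun i =>
    (constantFreeComplexity_mul_le _ _).trans (by rw [constantFreeComplexity_X, constantFreeComplexity_X])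
  calc ∑ i, constantFreeComplexity ((X (l i) : MvPolynomial Z ℤ) * X (z i)) +
        (Finset.univ : Finset ι).card
      ≤ ∑ _i : ι, 1 + (Finset.univ : Finset ι).card := by gcongr with i; exact h1 i
    _ = 2 * Fintype.card ι := by simp [two_mul]

omit [Fintype σ] in
/-- `aeval` only depends on the values at the occurring variables. [folklore] -/
private theorem aeval_congr_of_vars {Z : Type*} {A : Type*} [CommSemiring A] [Algebra ℤ A]
    {f g : Z → A} {P : MvPolynomial Z ℤ} (h : ∀ v ∈ P.vars, f v = g v) : aeval f P = aeval g P := by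
  simp only [MvPolynomial.aeval_def]
  exact MvPolynomial.eval₂Hom_congr' rfl (fun v hv _ => h v hv) rfl

/-- **The universal circuit-graph is ONE small CONSTANT-FREE circuit in inputs and labels**:
`τ(OUT) ≤ 2B + r · (rN) · (4B + 1)`, `B = #σ + rN`, for the flattened generic output
`OUT ∈ ℤ[Z ⊕ Y]` — the `τ`-twin of `complexity_jointOut_le` (same level-by-level substitution of
the node expressions, label VARIABLES in place of constant weights, so the only constants are
`0, 1`; Raz: "the labels are the only field elements used").
[cite: Raz2010, Prop. 2.8 (pp. 154–155), §3.2 (p. 157); ForbesShpilkaVolk2018, Lemma 13] -/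
theorem constantFreeComplexity_jointOut_le :
    constantFreeComplexity (jointOut ℤ σ r N) ≤ 2 * (Fintype.card σ + r * N) +
      r * ((r * N) * (4 * (Fintype.card σ + r * N) + 1)) := by
  -- adapted from `RazUniversal.complexity_jointOut_le` (RazUniversalJoint.lean), `τ` for `L`
  classical
  -- the degenerate graph `r = 0` outputs `0`
  rcases Nat.eq_zero_or_pos r with hr0 | hr1
  · subst hr0
    have h0 : jointOut ℤ σ 0 N = 0 := by
      rw [jointOut_eq]
      refine Finset.sum_eq_zero fun b _ => ?_
      rcases b with t | ⟨j, _⟩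
      · rw [jointBase_inl]; simp
      · exact j.elim0
    rw [h0, constantFreeComplexity_zero]
    exact Nat.zero_le _
  set B := Fintype.card σ + r * N with hB
  have hcardB : Fintype.card (BIdx σ r N) = B := by
    simp [BIdx, Fintype.card_sum, Fintype.card_prod, Fintype.card_fin, hB]
  set K := (r * N) * (4 * B + 1) with hK
  let Zt := (σ ⊕ Lab σ r N) ⊕ (Fin (r + 1) × BIdx σ r N)
  let V : Zt → MvPolynomial (σ ⊕ Lab σ r N) ℤ := Sum.elim X fun p => jointBase p.1 p.2
  let E : Fin (r + 1) → BIdx σ r N → MvPolynomial Zt ℤ := fun d =>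
    Sum.elim (fun t => if (d : ℕ) = 1 then X (Sum.inl (Sum.inl t)) else 0) fun jk =>
      if h : 1 ≤ (jk.1 : ℕ) ∧ (jk.1 : ℕ) < (d : ℕ) then
        (∑ b, (X (Sum.inl (Sum.inr (Sum.inl (d, jk.1, jk.2, false, b)))) : MvPolynomial Zt ℤ) *
            X (Sum.inr (Fin.castSucc jk.1, b))) *
          (∑ b, (X (Sum.inl (Sum.inr (Sum.inl (d, jk.1, jk.2, true, b)))) : MvPolynomial Zt ℤ) *
            X (Sum.inr (⟨(d : ℕ) - jk.1, by have := d.isLt; omega⟩, b)))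
      else 0
  let φ : Fin (r + 1) → Zt → MvPolynomial Zt ℤ := fun d =>
    Sum.elim (fun t => X (Sum.inl t)) fun p => if p.1 = d then E d p.2 else X (Sum.inr p)
  -- (F1) the defining expressions evaluate to the node polynomials
  have hE : ∀ d b, aeval V (E d b) = jointBase d b := by
    intro d b
    rcases b with t | ⟨j, k⟩
    · simp only [E, Sum.elim_inl]
      rw [jointBase_inl]
      split_ifs <;> simp [V]
    · simp only [E, Sum.elim_inr]
      by_cases h : 1 ≤ (j : ℕ) ∧ (j : ℕ) < (d : ℕ)
      · rw [dif_pos h, map_mul, aeval_varWeightedSum_int, aeval_varWeightedSum_int,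
          jointBase_inr d j k h]
        rfl
      · rw [dif_neg h, map_zero, jointBase_inr_of_not d j k h]
  -- (F2) hence `φ d` does not change the semantics
  have hφ : ∀ d z, aeval V (φ d z) = V z := by
    intro d z
    rcases z with t | p
    · simp [φ, V]
    · simp only [φ, Sum.elim_inr]
      split_ifs with hp
      · rw [hE]; simp [V, hp]
      · simp [V]
  have hφ' : ∀ d (T : MvPolynomial Zt ℤ), aeval V (aeval (φ d) T) = aeval V T := by
    intro d T
    rw [← AlgHom.comp_apply, comp_aeval]
    have : (fun i => aeval V (φ d i)) = V := funext (hφ d)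
    rw [this]
  -- (F3) cost of one level of substitutions
  have hcostE : ∀ d b, constantFreeComplexity (E d b) ≤ 4 * B + 1 := by
    intro d b
    rcases b with t | ⟨j, k⟩
    · simp only [E, Sum.elim_inl]
      split_ifs
      · rw [constantFreeComplexity_X]; omega
      · rw [constantFreeComplexity_zero]; omega
    · simp only [E, Sum.elim_inr]
      split_ifs
      · refine (constantFreeComplexity_mul_le _ _).trans ?_
        have h1 := constantFreeComplexity_varWeightedSum_le (Z := Zt)
          (fun b => Sum.inl (Sum.inr (Sum.inl (d, j, k, false, b))))
          (fun b => Sum.inr (Fin.castSucc j, b))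
        have h2 := constantFreeComplexity_varWeightedSum_le (Z := Zt)
          (fun b => Sum.inl (Sum.inr (Sum.inl (d, j, k, true, b))))
          (fun b => Sum.inr (⟨(d : ℕ) - j, by have := d.isLt; omega⟩, b))
        rw [hcardB] at h1 h2
        omega
      · rw [constantFreeComplexity_zero]; omega
  have hcostφ : ∀ d, ∑ z, constantFreeComplexity (φ d z) ≤ K := by
    intro d
    rw [hK, Fintype.sum_sum_type]
    have h0 : ∑ t : σ ⊕ Lab σ r N, constantFreeComplexity (φ d (Sum.inl t)) = 0 :=
      Finset.sum_eq_zero fun t _ => by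
        simp only [φ, Sum.elim_inl]; exact constantFreeComplexity_X _
    rw [h0, zero_add, Fintype.sum_prod_type]
    rw [Finset.sum_eq_single d]
    · simp only [φ, Sum.elim_inr, if_true]
      rw [Fintype.sum_sum_type]
      have hl : ∑ t : σ, constantFreeComplexity (E d (Sum.inl t)) = 0 :=
        Finset.sum_eq_zero fun t _ => by
          simp only [E, Sum.elim_inl]
          split_ifs
          · exact constantFreeComplexity_X _
          · exact constantFreeComplexity_zero
      rw [hl, zero_add]
      calc ∑ jk : Fin r × Fin N, constantFreeComplexity (E d (Sum.inr jk))
          ≤ ∑ _jk : Fin r × Fin N, (4 * B + 1) := Finset.sum_le_sum fun jk _ => hcostE d _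
        _ = (r * N) * (4 * B + 1) := by simp [Fintype.card_prod, Fintype.card_fin]
    · intro d' _ hne
      exact Finset.sum_eq_zero fun b _ => by
        simp only [φ, Sum.elim_inr, if_neg hne]; exact constantFreeComplexity_X _
    · intro h; exact absurd (Finset.mem_univ d) h
  -- (F4) the variables after expanding level `d`
  let inS : ℕ → Zt → Prop := fun m => Sum.elim (fun _ => True) fun p => 1 ≤ (p.1 : ℕ) ∧ (p.1 : ℕ) ≤ m
  have hvarsE : ∀ (d : Fin (r + 1)) b, ∀ v ∈ (E d b).vars, inS ((d : ℕ) - 1) v := by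
    intro d b v hv
    rcases b with t | ⟨j, k⟩
    · simp only [E, Sum.elim_inl] at hv
      split_ifs at hv
      · rw [vars_X] at hv
        have := Finset.mem_singleton.mp hv; subst this; trivial
      · simp at hv
    · simp only [E, Sum.elim_inr] at hv
      split_ifs at hv with h
      · rcases Finset.mem_union.mp (vars_mul _ _ hv) with h1 | h1
        · rcases Finset.mem_union.mp (vars_varWeightedSum_subset_int _ _ h1) with h3 | h3
          · obtain ⟨b, -, rfl⟩ := Finset.mem_image.mp h3
            trivial
          · obtain ⟨b, -, rfl⟩ := Finset.mem_image.mp h3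
            simp only [inS, Sum.elim_inr, Fin.val_castSucc]
            omega
        · rcases Finset.mem_union.mp (vars_varWeightedSum_subset_int _ _ h1) with h3 | h3
          · obtain ⟨b, -, rfl⟩ := Finset.mem_image.mp h3
            trivial
          · obtain ⟨b, -, rfl⟩ := Finset.mem_image.mp h3
            simp only [inS, Sum.elim_inr]
            omega
      · simp at hv
  have hvarsφ : ∀ (d : Fin (r + 1)) (T : MvPolynomial Zt ℤ), 1 ≤ (d : ℕ) →
      (∀ v ∈ T.vars, inS d v) → ∀ v ∈ (aeval (φ d) T).vars, inS ((d : ℕ) - 1) v := by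
    intro d T hd hT v hv
    rw [aeval_eq_bind₁] at hv
    obtain ⟨z, hz, hvz⟩ := Finset.mem_biUnion.mp (vars_bind₁ _ _ hv)
    have hzS := hT z hz
    rcases z with t | ⟨d', b⟩
    · simp only [φ, Sum.elim_inl] at hvz
      rw [vars_X] at hvz
      have := Finset.mem_singleton.mp hvz; subst this; trivial
    · simp only [φ, Sum.elim_inr] at hvz
      split_ifs at hvz with hp
      · subst hp; exact hvarsE _ _ v hvz
      · rw [vars_X] at hvz
        have := Finset.mem_singleton.mp hvz
        subst this
        simp only [inS, Sum.elim_inr] at hzS ⊢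
        have : (d' : ℕ) ≠ (d : ℕ) := fun h => hp (Fin.ext h)
        omega
  -- (F5) the top: output gate as a label-weighted sum of level-`r` symbols
  let top : MvPolynomial Zt ℤ :=
    ∑ b, (X (Sum.inl (Sum.inr (Sum.inr b))) : MvPolynomial Zt ℤ) * X (Sum.inr (Fin.last r, b))
  have htopV : aeval V top = jointOut ℤ σ r N := by
    simp only [top]
    rw [aeval_varWeightedSum_int, jointOut_eq]
    simp [V]
  have htopC : constantFreeComplexity top ≤ 2 * B := by
    have := constantFreeComplexity_varWeightedSum_le (Z := Zt)
      (fun b => Sum.inl (Sum.inr (Sum.inr b))) (fun b => Sum.inr (Fin.last r, b))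
    rwa [hcardB] at this
  have htopS : ∀ v ∈ top.vars, inS r v := by
    intro v hv
    rcases Finset.mem_union.mp (vars_varWeightedSum_subset_int _ _ hv) with h3 | h3
    · obtain ⟨b, -, rfl⟩ := Finset.mem_image.mp h3
      trivial
    · obtain ⟨b, -, rfl⟩ := Finset.mem_image.mp h3
      simp only [inS, Sum.elim_inr, Fin.val_last]
      omega
  -- (F6) expand the levels `r, r-1, …, 1`
  let U : ℕ → MvPolynomial Zt ℤ := fun i =>
    Nat.rec top (fun i acc => aeval (φ ⟨r - i, by omega⟩) acc) i
  have hU0 : U 0 = top := rfl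
  have hUs : ∀ i, U (i + 1) = aeval (φ ⟨r - i, by omega⟩) (U i) := fun i => rfl
  have hUV : ∀ i, aeval V (U i) = jointOut ℤ σ r N := by
    intro i
    induction i with
    | zero => rw [hU0, htopV]
    | succ i ih => rw [hUs, hφ', ih]
  have hUC : ∀ i, constantFreeComplexity (U i) ≤ 2 * B + i * K := by
    intro i
    induction i with
    | zero => rw [hU0]; simpa using htopC
    | succ i ih =>
      rw [hUs, add_mul, one_mul]
      refine (constantFreeComplexity_aeval_le _ _).trans ?_
      have := hcostφ ⟨r - i, by omega⟩
      omega
  have hUvars : ∀ i, i ≤ r → ∀ v ∈ (U i).vars, inS (r - i) v := by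
    intro i
    induction i with
    | zero => intro _ v hv; rw [hU0] at hv; simpa using htopS v hv
    | succ i ih =>
      intro hi v hv
      rw [hUs] at hv
      have h := hvarsφ ⟨r - i, by omega⟩ (U i) (by simp; omega) (ih (by omega)) v hv
      simp only at h
      rwa [show r - i - 1 = r - (i + 1) by omega] at h
  -- (F7) after `r` steps only input symbols remain, so the substitution `V` may be replaced by
  -- the free one `V₀ = (X, 0)`: `OUT = aeval V₀ (U r)` at no cost
  let V₀ : Zt → MvPolynomial (σ ⊕ Lab σ r N) ℤ := Sum.elim X fun _ => 0
  have hV₀ : aeval V₀ (U r) = jointOut ℤ σ r N := by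
    rw [← hUV r]
    refine aeval_congr_of_vars fun v hv => ?_
    have h := hUvars r le_rfl v hv
    rcases v with t | p
    · rfl
    · simp only [inS, Sum.elim_inr, Nat.sub_self] at h; omega
  have hcostV₀ : ∑ z, constantFreeComplexity (V₀ z) = 0 :=
    Finset.sum_eq_zero fun z _ => by
      rcases z with t | p
      · exact constantFreeComplexity_X _
      · exact constantFreeComplexity_zero
  calc constantFreeComplexity (jointOut ℤ σ r N) = constantFreeComplexity (aeval V₀ (U r)) := by
        rw [hV₀]
    _ ≤ constantFreeComplexity (U r) + ∑ z, constantFreeComplexity (V₀ z) :=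
        constantFreeComplexity_aeval_le _ _
    _ ≤ 2 * B + r * K := by rw [hcostV₀, add_zero]; exact hUC r

/-- Polynomial form for `σ = Fin n`: `τ(OUT) ≤ 7 (n + r + N + 1)^5` (`τ`-twin of
`complexity_jointOut_le_poly`). [cite: Raz2010, Prop. 2.8, Prop. 3.3 (p. 158)] -/
theorem constantFreeComplexity_jointOut_le_poly {n : ℕ} :
    constantFreeComplexity (jointOut ℤ (Fin n) r N) ≤ 7 * (n + r + N + 1) ^ 5 := by
  refine (constantFreeComplexity_jointOut_le (σ := Fin n) (r := r) (N := N)).trans ?_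
  rw [Fintype.card_fin]
  set T := n + r + N + 1 with hT
  have hn : n ≤ T := by omega
  have hr : r ≤ T := by omega
  have hN : N ≤ T := by omega
  have h1 : 1 ≤ T := by omega
  have hB : n + r * N ≤ T ^ 2 := by nlinarith
  have h12 : 1 ≤ T ^ 2 := Nat.one_le_pow _ _ h1
  have h25 : T ^ 2 ≤ T ^ 5 := Nat.pow_le_pow_right h1 (by norm_num)
  calc 2 * (n + r * N) + r * (r * N * (4 * (n + r * N) + 1))
      ≤ 2 * T ^ 2 + T * (T * T * (4 * T ^ 2 + T ^ 2)) := by gcongr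
    _ = 2 * T ^ 2 + 5 * T ^ 5 := by ring
    _ ≤ 7 * T ^ 5 := by omega

end Joint

/-! ### §2. The integer universal circuit is constant-free -/

section Universal

/-- `τ(m) ≤ m` for a natural number constant (`m = 1 + 1 + ⋯ + 1`; Bürgisser: `τ(k) ≤ 2 log k`
would be optimal, the linear bound suffices here). [cite: Burgisser2000, §1.4] -/
theorem constantFreeComplexity_C_natCast_le {σ : Type v} (m : ℕ) :
    constantFreeComplexity (C (m : ℤ) : MvPolynomial σ ℤ) ≤ m := by
  induction m with
  | zero => simp
  | succ m ih =>
    rw [Nat.cast_succ, C_add, C_1]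
    calc constantFreeComplexity (C (m : ℤ) + 1 : MvPolynomial σ ℤ)
        ≤ constantFreeComplexity (C (m : ℤ) : MvPolynomial σ ℤ) +
            constantFreeComplexity (1 : MvPolynomial σ ℤ) + 1 := constantFreeComplexity_add_le _ _
      _ ≤ m + 0 + 1 := by rw [constantFreeComplexity_one]; gcongr
      _ = m + 1 := by ring

/-- The total degree of a symbol is `≤ 1` over any commutative semiring (twin of the private
lemma of `UniversalCircuit.lean`). [folklore] -/
private theorem totalDegree_X_le_one'' {A : Type u} [CommSemiring A] {Z : Type*} (v : Z) :
    (X v : MvPolynomial Z A).totalDegree ≤ 1 := by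
  classical
  by_cases h1 : (1 : A) = 0
  · have h0 : (X v : MvPolynomial Z A) = 0 := by
      show monomial (Finsupp.single v 1) (1 : A) = 0
      rw [h1, monomial_zero]
    rw [h0, totalDegree_zero]
    exact Nat.zero_le _
  · haveI : Nontrivial A := nontrivial_of_ne 1 0 h1
    rw [totalDegree_X]

/-- Arithmetic for the universal circuit (twin of the private `universal_aux_le` of
`UniversalCircuit.lean`): with `T = n + d + s + 2`, `n + (k+1) + 4 (d+2)² s (d+1)² + 1 ≤ 5 T⁵` for
`k < d`. [folklore] -/
private theorem universal_aux_le'' {n s d k : ℕ} (hk : k < d) :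
    n + (k + 1) + 4 * ((d + 2) ^ 2 * s) * (d + 1) ^ 2 + 1 ≤ 5 * (n + d + s + 2) ^ 5 := by
  set T := n + d + s + 2 with hT
  have h1 : 1 ≤ T := by omega
  have hd2 : d + 2 ≤ T := by omega
  have hd1 : d + 1 ≤ T := by omega
  have hs : s ≤ T := by omega
  have hW : 4 * ((d + 2) ^ 2 * s) * (d + 1) ^ 2 ≤ 4 * T ^ 5 := by
    calc 4 * ((d + 2) ^ 2 * s) * (d + 1) ^ 2 ≤ 4 * (T ^ 2 * T) * T ^ 2 := by gcongr
      _ = 4 * T ^ 5 := by ring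
  have hT5 : T ≤ T ^ 5 := Nat.le_self_pow (by norm_num) T
  have hnk : n + (k + 1) + 1 ≤ T := by omega
  omega

/-- **The universal circuit over `ℤ` is CONSTANT-FREE (Raz 2010; Forbes–Shpilka–Volk 2018,
Thm. 12; the form Chatterjee–Tengse's Lemma 4.7 uses).** For all `n, s, d` there are
`p ≤ 9376 (n+d+s+2)²⁶` parameters and ONE integer polynomial `U ∈ ℤ[x₁,…,x_n, y₁,…,y_p]` of
CONSTANT-FREE fan-in-two complexity `τ(U) ≤ 21877 (n+d+s+2)²⁶` (all constants and sum
coefficients in `{0, 1, −1}`), every monomial of which has degree `≤ d` in the `x`-variables, of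
total degree `≤ 3d + 1`, such that for EVERY commutative ring `R` every `f ∈ R[x₁,…,x_n]` of total
degree `≤ d` and complexity `≤ s` over `R` is a specialisation `f = U_R(x, α)` of the `y`-variables
of `U_R := map (ℤ → R) U` to constants `α ∈ R^p`. Same construction and universality proof as
`exists_universalCircuit_int` (`U = y₀ + Σ_{k=1}^{d} OUT_k(x, y_k)`); the size is measured by
`constantFreeComplexity_jointOut_le_poly`. ("𝒰 … is constant-free", Chatterjee–Tengse; "the labels
are the only field elements", Raz §3.2.)
[cite: ForbesShpilkaVolk2018, Thm. 12 (seq.) = ToC Thm. 3.1; Raz2010, Prop. 3.3 (p. 158), §3.2 (p. 157); ChatterjeeTengse2023, proof of Lemma 4.7 (v1: Lemma 50; p0017.txt:L58–L70)] -/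
theorem exists_universalCircuit_int_constantFree (n s d : ℕ) :
    ∃ (p : ℕ) (U : MvPolynomial (Fin n ⊕ Fin p) ℤ),
      p ≤ 9376 * (n + d + s + 2) ^ 26 ∧
      constantFreeComplexity U ≤ 21877 * (n + d + s + 2) ^ 26 ∧
      (∀ e ∈ U.support, ∑ i : Fin n, e (Sum.inl i) ≤ d) ∧
      U.totalDegree ≤ 3 * d + 1 ∧
      ∀ (R : Type u) [CommRing R] (f : MvPolynomial (Fin n) R),
        f.totalDegree ≤ d → complexity f ≤ s →
          ∃ α : Fin p → R,
            aeval (Sum.elim X fun j => C (α j)) (MvPolynomial.map (Int.castRingHom R) U) = f := by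
  -- adapted from `RazUniversal.exists_universalCircuit_int` (UniversalCircuitInt.lean), `τ` for `L`
  classical
  set s' := (d + 2) ^ 2 * s with hs'
  set W := 4 * s' * (d + 1) ^ 2 with hW
  obtain ⟨T, hT⟩ : ∃ T, n + d + s + 2 = T := ⟨_, rfl⟩
  rw [hT]
  let L : Fin d → Type := fun k => Lab (Fin n) ((k : ℕ) + 1) W
  let P := Unit ⊕ (Σ k : Fin d, L k)
  let e := Fintype.equivFin P
  let ι : ∀ k : Fin d, Fin n ⊕ L k → Fin n ⊕ Fin (Fintype.card P) := fun k =>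
    Sum.map id fun l => e (Sum.inr ⟨k, l⟩)
  have hinj : ∀ k, Function.Injective (ι k) := fun k =>
    Sum.map_injective.2 ⟨fun _ _ h => h,
      fun a b h => sigma_mk_injective (Sum.inr_injective (e.injective h))⟩
  -- the construction over an arbitrary commutative semiring `A`
  let J : ∀ (A : Type u) [CommSemiring A], Fin d → MvPolynomial (Fin n ⊕ Fin (Fintype.card P)) A :=
    fun A _ k => rename (ι k) (jointOut A (Fin n) ((k : ℕ) + 1) W)
  let UA : ∀ (A : Type u) [CommSemiring A], MvPolynomial (Fin n ⊕ Fin (Fintype.card P)) A :=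
    fun A _ => X (Sum.inr (e (Sum.inl ()))) + ∑ k, J A k
  let JZ : Fin d → MvPolynomial (Fin n ⊕ Fin (Fintype.card P)) ℤ :=
    fun k => rename (ι k) (jointOut ℤ (Fin n) ((k : ℕ) + 1) W)
  let U : MvPolynomial (Fin n ⊕ Fin (Fintype.card P)) ℤ := X (Sum.inr (e (Sum.inl ()))) + ∑ k, JZ k
  -- base change: `map (ℤ → A) U = U_A`
  have hmapU : ∀ (A : Type u) [CommRing A], MvPolynomial.map (Int.castRingHom A) U = UA A := by
    intro A _
    simp only [U, UA, map_add, map_X, map_sum]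
    congr 1
    refine Finset.sum_congr rfl fun k _ => ?_
    simp only [JZ, J, map_rename]
    rw [map_jointOut (Int.castRingHom A)]
  have h1T : 1 ≤ T := by omega
  have hT26 : 1 ≤ T ^ 26 := Nat.one_le_pow _ _ h1T
  have hdT : d ≤ T := by omega
  -- the polynomial bounds per level
  have hlvl : ∀ k : Fin d, n + ((k : ℕ) + 1) + W + 1 ≤ 5 * T ^ 5 := fun k => by
    rw [hW, hs', ← hT]; exact universal_aux_le'' k.isLt
  have hpow : ∀ k : Fin d, (n + ((k : ℕ) + 1) + W + 1) ^ 5 ≤ 3125 * T ^ 25 := fun k => by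
    calc (n + ((k : ℕ) + 1) + W + 1) ^ 5 ≤ (5 * T ^ 5) ^ 5 := Nat.pow_le_pow_left (hlvl k) 5
      _ = 3125 * T ^ 25 := by ring
  refine ⟨Fintype.card P, U, ?_, ?_, ?_, ?_, ?_⟩
  · -- parameter count
    have hP : Fintype.card P = 1 + ∑ k : Fin d, Fintype.card (L k) := by
      simp [P, Fintype.card_sum, Fintype.card_sigma]
    rw [hP]
    have hL : ∀ k : Fin d, Fintype.card (L k) ≤ 9375 * T ^ 25 := fun k => by
      calc Fintype.card (L k) ≤ 3 * (Fintype.card (Fin n) + ((k : ℕ) + 1) + W + 1) ^ 5 :=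
            card_lab_le (Fin n) _ W
        _ = 3 * (n + ((k : ℕ) + 1) + W + 1) ^ 5 := by rw [Fintype.card_fin]
        _ ≤ 3 * (3125 * T ^ 25) := Nat.mul_le_mul_left 3 (hpow k)
        _ = 9375 * T ^ 25 := by ring
    calc 1 + ∑ k : Fin d, Fintype.card (L k) ≤ 1 + ∑ _k : Fin d, 9375 * T ^ 25 := by
          gcongr with k; exact hL k
      _ = 1 + d * (9375 * T ^ 25) := by simp
      _ ≤ T ^ 26 + T * (9375 * T ^ 25) := by gcongr
      _ = 9376 * T ^ 26 := by ring
  · -- CONSTANT-FREE size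
    have hJc : ∀ k : Fin d, constantFreeComplexity (JZ k) ≤ 21875 * T ^ 25 := fun k => by
      calc constantFreeComplexity (JZ k)
          ≤ constantFreeComplexity (jointOut ℤ (Fin n) ((k : ℕ) + 1) W) :=
            constantFreeComplexity_rename_le _ _
        _ ≤ 7 * (n + ((k : ℕ) + 1) + W + 1) ^ 5 := constantFreeComplexity_jointOut_le_poly
        _ ≤ 7 * (3125 * T ^ 25) := Nat.mul_le_mul_left 7 (hpow k)
        _ = 21875 * T ^ 25 := by ring
    calc constantFreeComplexity U
        ≤ constantFreeComplexity
              (X (Sum.inr (e (Sum.inl ()))) : MvPolynomial (Fin n ⊕ Fin (Fintype.card P)) ℤ) +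
            constantFreeComplexity (∑ k, JZ k) + 1 := constantFreeComplexity_add_le _ _
      _ ≤ 0 + (∑ k, constantFreeComplexity (JZ k) + (Finset.univ : Finset (Fin d)).card) + 1 := by
          rw [constantFreeComplexity_X]
          gcongr
          exact constantFreeComplexity_finset_sum_le _ _
      _ ≤ 0 + (∑ _k : Fin d, 21875 * T ^ 25 + (Finset.univ : Finset (Fin d)).card) + 1 := by
          gcongr with k; exact hJc k
      _ = d * (21875 * T ^ 25) + d + 1 := by simp
      _ ≤ T * (21875 * T ^ 25) + T ^ 26 + T ^ 26 := by
          gcongr; exact hdT.trans (Nat.le_self_pow (by norm_num) T)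
      _ = 21877 * T ^ 26 := by ring
  · -- degree in the inputs
    intro ex hex
    rcases Finset.mem_union.mp (support_add hex) with h1 | h1
    · change ex ∈ (monomial (Finsupp.single (Sum.inr (e (Sum.inl ()))) 1) (1 : ℤ)).support at h1
      have hex1 := Finset.mem_singleton.mp (support_monomial_subset h1)
      subst hex1
      simp
    · obtain ⟨k, -, hk⟩ := Finset.mem_biUnion.mp (support_sum h1)
      simp only [JZ] at hk
      rw [support_rename_of_injective (hinj k)] at hk
      obtain ⟨e', he', rfl⟩ := Finset.mem_image.mp hk
      have hsum := sum_inl_eq_of_mem_support_jointOut (R := ℤ) he'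
      calc ∑ i : Fin n, Finsupp.mapDomain (ι k) e' (Sum.inl i) = ∑ i : Fin n, e' (Sum.inl i) := by
            refine Finset.sum_congr rfl fun i _ => ?_
            have : (Sum.inl i : Fin n ⊕ Fin (Fintype.card P)) = ι k (Sum.inl i) := rfl
            rw [this, Finsupp.mapDomain_apply (hinj k)]
        _ = (k : ℕ) + 1 := hsum
        _ ≤ d := k.isLt
  · -- total degree
    refine (totalDegree_add _ _).trans (max_le ((totalDegree_X_le_one'' _).trans (by omega)) ?_)
    refine totalDegree_finsetSum_le fun k _ => (totalDegree_rename_le _ _).trans ?_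
    refine (totalDegree_jointOut_le (R := ℤ) (σ := Fin n) (r := (k : ℕ) + 1) (N := W)).trans ?_
    have := k.isLt
    omega
  · -- universality, over an arbitrary commutative ring `R`
    intro R _ f hfd hfs
    have hlab : ∀ k : Fin d, ∃ y : L k → R, outVal y = homogeneousComponent ((k : ℕ) + 1) f := by
      intro k
      have hk1 : 1 ≤ (k : ℕ) + 1 := by omega
      have hg : (homogeneousComponent ((k : ℕ) + 1) f).IsHomogeneous ((k : ℕ) + 1) :=
        homogeneousComponent_isHomogeneous _ _
      have hgc : complexity (homogeneousComponent ((k : ℕ) + 1) f) ≤ s' := by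
        refine (complexity_homogeneousComponent_le_sq_mul f _).trans ?_
        rw [hs']
        have hk2 : ((k : ℕ) + 1 + 2) ^ 2 ≤ (d + 2) ^ 2 :=
          Nat.pow_le_pow_left (by have := k.isLt; omega) 2
        exact Nat.mul_le_mul hk2 hfs
      have hN : 4 * s' * ((k : ℕ) + 1 + 1) ^ 2 ≤ W := by
        rw [hW]
        have hk2 : (k : ℕ) + 1 + 1 ≤ d + 1 := by have := k.isLt; omega
        exact Nat.mul_le_mul_left _ (Nat.pow_le_pow_left hk2 2)
      exact exists_labels_of_complexity_le (R := R) (σ := Fin n) (r := (k : ℕ) + 1) (N := W)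
        hk1 hN hg hgc
    choose y hy using hlab
    let Y : P → R := Sum.elim (fun _ => coeff 0 f) (fun kl => y kl.1 kl.2)
    refine ⟨Y ∘ e.symm, ?_⟩
    rw [hmapU R]
    have hJ : ∀ k, aeval (Sum.elim X fun j => C ((Y ∘ e.symm) j)) (J R k) =
        homogeneousComponent ((k : ℕ) + 1) f := by
      intro k
      simp only [J]
      rw [aeval_rename]
      have hfun : ((Sum.elim X fun j => C ((Y ∘ e.symm) j)) ∘ ι k :
          Fin n ⊕ L k → MvPolynomial (Fin n) R) = Sum.elim X fun l => C (y k l) := by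
        funext v
        rcases v with t | l
        · rfl
        · simp [ι, Y]
      rw [hfun, aeval_labels_jointOut, hy]
    have hspec : aeval (Sum.elim X fun j => C ((Y ∘ e.symm) j)) (UA R) =
        C (coeff 0 f) + ∑ k : Fin d, homogeneousComponent ((k : ℕ) + 1) f := by
      simp only [UA]
      rw [map_add, map_sum, aeval_X]
      congr 1
      · simp [Y]
      · exact Finset.sum_congr rfl fun k _ => hJ k
    rw [hspec, ← homogeneousComponent_zero]
    have hsub : Finset.range (f.totalDegree + 1) ⊆ Finset.range (d + 1) :=
      Finset.range_subset_range.mpr (by omega)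
    calc homogeneousComponent 0 f + ∑ k : Fin d, homogeneousComponent ((k : ℕ) + 1) f
        = ∑ i ∈ Finset.range (d + 1), homogeneousComponent i f := by
          rw [Finset.sum_range_succ', Finset.sum_range]
          exact add_comm _ _
      _ = ∑ i ∈ Finset.range (f.totalDegree + 1), homogeneousComponent i f := by
          refine (Finset.sum_subset hsub fun i _ hi' => ?_).symm
          apply homogeneousComponent_eq_zero
          simp only [Finset.mem_range] at hi'
          omega
      _ = f := sum_homogeneousComponent f

end Universal

end RazUniversal

end Literature.Computability.AlgebraicComplexity

end
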